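import Mathlib.Analysis.Calculus.MeanValue
import Mathlib.Analysis.SpecialFunctions.Log.Deriv
import Mathlib.Analysis.SpecialFunctions.ExpDeriv
import Mathlib.Analysis.SpecialFunctions.Pow.Real
import Mathlib.Analysis.SpecialFunctions.Pow.Continuity
import Summits.CriticalPhenomena.PercolationContinuityZ3.Theorems.PercNearOneGluingNoHeavyLowerTailAPLProfileEdgeAnalytic
import Summits.CriticalPhenomena.PercolationContinuityZ3.Theorems.PercNearOneGluingNoHeavyLowerTailAPLFamilyPhi
import HarnessLib

/-!
# `NoHeavyLowerTail` (stmt-CriticalPhenomena-4575) — the ADMISSIBLE FAMILY of profile rows, part 2: LEMMA Q_{αβ} — every admissible row `U^{α+β} ≤ A·B^β·C^α` is quasi-convex along an apex edge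

Support file (prover prim-ineq-gen-8 gen 38; `--supports stmt-CriticalPhenomena-4575`; memo
run/shared/lean/prim/prim-ineq-gen-8/FINDING-gen38-APLG-ALL.md §1).  Pure real analysis: no definitions, no named facts, no sorries.

Exponent-generic analogue of gen 37's `…APLProfileEdgeAnalytic` (real powers `Real.rpow`).  With `X(z) = X₀ − z(X₀ − X₁)` for
`X ∈ {U, A, B, C}` (the four isolation probabilities along the weight of one apex edge) and an ADMISSIBLE pair `(α,β)`
(`α, β ≥ 1`, `αβ(α+β+1) ≥ (α+β)²`):
* `hasDerivAt_Lfam`, `quot_eq_exp_Lfam`, `hasDerivAt_quot_fam`, `continuousOn_quot_fam` — the derivative of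
  `R = U^{α+β}/(A·B^β·C^α)` is `R·ψ`, `ψ = −(α+β)dU/U + dA/A + βdB/B + αdC/C` (via `R = exp((α+β) log U − log A − β log B − α log C)`);
* **`family_edge_mixture_pos`**, **`family_edge_mixture`** (and the `(1−z)X₀ + zX₁` form `family_edge_mixture'`) — LEMMA Q_{αβ}: `U₀^{α+β} ≤ A₀B₀^βC₀^α`, `U₁^{α+β} ≤ A₁B₁^βC₁^α` and ROW Π
  `U₀((B₀−B₁)C₀ + (C₀−C₁)B₀) ≤ (U₀−U₁)B₀C₀` imply `U(z)^{α+β} ≤ A(z)B(z)^βC(z)^α` for every `z ∈ [0,1]` (mean value theorem +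
  `psi_propagate_fam`; degenerate endpoints by `ε ↓ 0`).
This is the step that makes gen 37's induction run for every admissible row (file `…APLFamilyAll`). [this work]
-/

namespace Summit.CriticalPhenomena.PercolationContinuityZ3.Theorems

namespace APL

/-! ### Derivatives of `L = (α+β) log U − log A − β log B − α log C` and of the quotient `R = U^{α+β}/(A B^β C^α)` -/

/-- The derivative of `L(z) = (α+β) log U(z) − log A(z) − β log B(z) − α log C(z)` is
`ψ(z) = −(α+β)dU/U + dA/A + βdB/B + αdC/C`. [folklore] -/
theorem hasDerivAt_Lfam (α β U0 dU A0 dA B0 dB C0 dC z : ℝ) (hU : U0 - z * dU ≠ 0) (hA : A0 - z * dA ≠ 0)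
    (hB : B0 - z * dB ≠ 0) (hC : C0 - z * dC ≠ 0) :
    HasDerivAt (fun z => (α + β) * Real.log (U0 - z * dU) - Real.log (A0 - z * dA) - β * Real.log (B0 - z * dB)
        - α * Real.log (C0 - z * dC))
      (-(α + β) * (dU / (U0 - z * dU)) + dA / (A0 - z * dA) + β * (dB / (B0 - z * dB)) + α * (dC / (C0 - z * dC))) z := by
  have hu := (hasDerivAt_log_affine U0 dU z hU).const_mul (α + β)
  have ha := hasDerivAt_log_affine A0 dA z hA
  have hb := (hasDerivAt_log_affine B0 dB z hB).const_mul β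
  have hc := (hasDerivAt_log_affine C0 dC z hC).const_mul α
  refine (((hu.sub ha).sub hb).sub hc).congr_deriv ?_
  ring

/-- On `{U, A, B, C > 0}` the quotient `U^{α+β}/(A B^β C^α)` is `exp L`. [folklore] -/
theorem quot_eq_exp_Lfam (α β u a b c : ℝ) (hu : 0 < u) (ha : 0 < a) (hb : 0 < b) (hc : 0 < c) :
    u ^ (α + β) / (a * b ^ β * c ^ α)
      = Real.exp ((α + β) * Real.log u - Real.log a - β * Real.log b - α * Real.log c) := by
  rw [Real.exp_sub, Real.exp_sub, Real.exp_sub, Real.exp_log ha]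
  rw [Real.rpow_def_of_pos hu, Real.rpow_def_of_pos hb, Real.rpow_def_of_pos hc]
  rw [mul_comm (α + β) (Real.log u), mul_comm β (Real.log b), mul_comm α (Real.log c)]
  field_simp

/-- The derivative of the quotient `R(z) = U(z)^{α+β}/(A(z)B(z)^βC(z)^α)` at a point where all four are positive: `R' = R·ψ`. [folklore] -/
theorem hasDerivAt_quot_fam (α β U0 dU A0 dA B0 dB C0 dC z : ℝ) (hU : 0 < U0 - z * dU) (hA : 0 < A0 - z * dA)
    (hB : 0 < B0 - z * dB) (hC : 0 < C0 - z * dC) :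
    HasDerivAt (fun z => (U0 - z * dU) ^ (α + β) / ((A0 - z * dA) * (B0 - z * dB) ^ β * (C0 - z * dC) ^ α))
      ((U0 - z * dU) ^ (α + β) / ((A0 - z * dA) * (B0 - z * dB) ^ β * (C0 - z * dC) ^ α)
        * (-(α + β) * (dU / (U0 - z * dU)) + dA / (A0 - z * dA) + β * (dB / (B0 - z * dB)) + α * (dC / (C0 - z * dC)))) z := by
  have hO : IsOpen {y : ℝ | 0 < U0 - y * dU ∧ 0 < A0 - y * dA ∧ 0 < B0 - y * dB ∧ 0 < C0 - y * dC} := by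
    have cU : Continuous fun y : ℝ => U0 - y * dU := by fun_prop
    have cA : Continuous fun y : ℝ => A0 - y * dA := by fun_prop
    have cB : Continuous fun y : ℝ => B0 - y * dB := by fun_prop
    have cC : Continuous fun y : ℝ => C0 - y * dC := by fun_prop
    exact (isOpen_lt continuous_const cU).inter ((isOpen_lt continuous_const cA).inter
      ((isOpen_lt continuous_const cB).inter (isOpen_lt continuous_const cC)))
  have hmem : z ∈ {y : ℝ | 0 < U0 - y * dU ∧ 0 < A0 - y * dA ∧ 0 < B0 - y * dB ∧ 0 < C0 - y * dC} := ⟨hU, hA, hB, hC⟩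
  have hev : (fun y => (U0 - y * dU) ^ (α + β) / ((A0 - y * dA) * (B0 - y * dB) ^ β * (C0 - y * dC) ^ α))
      =ᶠ[nhds z] (fun y => Real.exp ((α + β) * Real.log (U0 - y * dU) - Real.log (A0 - y * dA)
        - β * Real.log (B0 - y * dB) - α * Real.log (C0 - y * dC))) := by
    filter_upwards [hO.mem_nhds hmem] with y hy
    exact quot_eq_exp_Lfam α β _ _ _ _ hy.1 hy.2.1 hy.2.2.1 hy.2.2.2
  have hexp := (hasDerivAt_Lfam α β U0 dU A0 dA B0 dB C0 dC z hU.ne' hA.ne' hB.ne' hC.ne').exp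
  rw [← quot_eq_exp_Lfam α β _ _ _ _ hU hA hB hC] at hexp
  exact hexp.congr_of_eventuallyEq hev

/-- Continuity of the quotient on a set where `U ≥ 0` and `A, B, C > 0`. [folklore] -/
theorem continuousOn_quot_fam (α β U0 dU A0 dA B0 dB C0 dC : ℝ) (hn : 0 ≤ α + β) (hα : 0 ≤ α) (hβ : 0 ≤ β) (s : Set ℝ)
    (hs : ∀ y ∈ s, (A0 - y * dA) * (B0 - y * dB) ^ β * (C0 - y * dC) ^ α ≠ 0) :
    ContinuousOn (fun z => (U0 - z * dU) ^ (α + β) / ((A0 - z * dA) * (B0 - z * dB) ^ β * (C0 - z * dC) ^ α)) s := by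
  refine ContinuousOn.div ?_ ?_ hs
  · exact ((Continuous.continuousOn (s := s) (by fun_prop : Continuous fun z : ℝ => U0 - z * dU)).rpow_const
      fun y _ => Or.inr hn)
  · refine ContinuousOn.mul (ContinuousOn.mul (Continuous.continuousOn (by fun_prop)) ?_) ?_
    · exact (Continuous.continuousOn (s := s) (by fun_prop : Continuous fun z : ℝ => B0 - z * dB)).rpow_const
        fun y _ => Or.inr hβ
    · exact (Continuous.continuousOn (s := s) (by fun_prop : Continuous fun z : ℝ => C0 - z * dC)).rpow_const
        fun y _ => Or.inr hα

/-! ### LEMMA Q_{αβ} -/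

set_option maxHeartbeats 1600000 in
/-- **LEMMA Q_{αβ}, non-degenerate case** (`U₀, A₀ > 0`, `A₁, B₁, C₁ > 0`).  For an admissible pair `(α,β)`: if `U₀^{α+β} ≤ A₀B₀^βC₀^α`,
`U₁^{α+β} ≤ A₁B₁^βC₁^α` and ROW Π `U₀((B₀−B₁)C₀ + (C₀−C₁)B₀) ≤ (U₀−U₁)B₀C₀`, then `U(z)^{α+β} ≤ A(z)B(z)^βC(z)^α` for every `z ∈ [0,1]`,
`X(z) = X₀ − z(X₀−X₁)`.  Proof as in gen 37: the quotient `R` is continuous on `[0,1]`; if `R(z) > max(R(0),R(1))` the mean value theorem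
gives `z₁ < z` with `ψ(z₁) > 0`, propagation (`psi_propagate_fam`, fed by `rowPi_propagate`) gives `ψ ≥ 0` on `[z₁,1)`, so `R` is
non-decreasing on `[z₁,1]` and `R(1) ≥ R(z)`, a contradiction. [this work] -/
theorem family_edge_mixture_pos (α β : ℝ) (hα : 1 ≤ α) (hβ : 1 ≤ β) (hadm : (α + β) ^ 2 ≤ α * β * (α + β + 1))
    (U0 U1 A0 A1 B0 B1 C0 C1 : ℝ) (hU0 : 0 < U0) (hU1 : 0 ≤ U1)
    (hA0 : 0 < A0) (hA1 : 0 < A1) (hB1 : 0 < B1) (hB : B1 ≤ B0) (hC1 : 0 < C1) (hC : C1 ≤ C0)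
    (h0 : U0 ^ (α + β) ≤ A0 * B0 ^ β * C0 ^ α) (h1 : U1 ^ (α + β) ≤ A1 * B1 ^ β * C1 ^ α)
    (hPi : U0 * ((B0 - B1) * C0 + (C0 - C1) * B0) ≤ (U0 - U1) * B0 * C0) :
    ∀ z ∈ Set.Icc (0 : ℝ) 1,
      (U0 - z * (U0 - U1)) ^ (α + β) ≤ (A0 - z * (A0 - A1)) * (B0 - z * (B0 - B1)) ^ β * (C0 - z * (C0 - C1)) ^ α := by
  have hα0 : 0 ≤ α := zero_le_one.trans hα
  have hβ0 : 0 ≤ β := zero_le_one.trans hβ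
  have hn0 : 0 ≤ α + β := add_nonneg hα0 hβ0
  -- positivity of the affine functions on `[0,1]` (and of `U` on `[0,1)`)
  have hB0 : 0 < B0 := lt_of_lt_of_le hB1 hB
  have hC0 : 0 < C0 := lt_of_lt_of_le hC1 hC
  have posA : ∀ y ∈ Set.Icc (0 : ℝ) 1, 0 < A0 - y * (A0 - A1) := by
    intro y hy; obtain ⟨h0', h1'⟩ := hy
    have : A0 - y * (A0 - A1) = (1 - y) * A0 + y * A1 := by ring
    rw [this]
    rcases eq_or_lt_of_le h1' with rfl | hlt
    · simpa using hA1
    · nlinarith [mul_nonneg h0' hA1.le]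
  have posB : ∀ y ∈ Set.Icc (0 : ℝ) 1, 0 < B0 - y * (B0 - B1) := by
    intro y hy; obtain ⟨h0', h1'⟩ := hy; nlinarith [mul_nonneg h0' hB1.le]
  have posC : ∀ y ∈ Set.Icc (0 : ℝ) 1, 0 < C0 - y * (C0 - C1) := by
    intro y hy; obtain ⟨h0', h1'⟩ := hy; nlinarith [mul_nonneg h0' hC1.le]
  have posU : ∀ y, 0 ≤ y → y < 1 → 0 < U0 - y * (U0 - U1) := by
    intro y h0' h1'; nlinarith [mul_nonneg h0' hU1]
  have nnU : ∀ y ∈ Set.Icc (0 : ℝ) 1, 0 ≤ U0 - y * (U0 - U1) := by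
    intro y hy; obtain ⟨h0', h1'⟩ := hy; nlinarith [mul_nonneg h0' hU1]
  set R : ℝ → ℝ := fun z => (U0 - z * (U0 - U1)) ^ (α + β) /
      ((A0 - z * (A0 - A1)) * (B0 - z * (B0 - B1)) ^ β * (C0 - z * (C0 - C1)) ^ α) with hRdef
  set ψ : ℝ → ℝ := fun z => -(α + β) * ((U0 - U1) / (U0 - z * (U0 - U1))) + (A0 - A1) / (A0 - z * (A0 - A1))
      + β * ((B0 - B1) / (B0 - z * (B0 - B1))) + α * ((C0 - C1) / (C0 - z * (C0 - C1))) with hψdef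
  have denpos : ∀ y ∈ Set.Icc (0 : ℝ) 1,
      0 < (A0 - y * (A0 - A1)) * (B0 - y * (B0 - B1)) ^ β * (C0 - y * (C0 - C1)) ^ α := by
    intro y hy
    exact mul_pos (mul_pos (posA y hy) (Real.rpow_pos_of_pos (posB y hy) β)) (Real.rpow_pos_of_pos (posC y hy) α)
  have Rnn : ∀ y ∈ Set.Icc (0 : ℝ) 1, 0 ≤ R y := by
    intro y hy
    exact div_nonneg (Real.rpow_nonneg (nnU y hy) (α + β)) (denpos y hy).le
  have Rcont : ContinuousOn R (Set.Icc 0 1) :=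
    continuousOn_quot_fam α β _ _ _ _ _ _ _ _ hn0 hα0 hβ0 _ fun y hy => (denpos y hy).ne'
  have Rderiv : ∀ y, 0 ≤ y → y < 1 → HasDerivAt R (R y * ψ y) y := by
    intro y h0' h1'
    exact hasDerivAt_quot_fam α β _ _ _ _ _ _ _ _ y (posU y h0' h1') (posA y ⟨h0', h1'.le⟩) (posB y ⟨h0', h1'.le⟩)
      (posC y ⟨h0', h1'.le⟩)
  -- the endpoint values are at most `1`
  have R0 : R 0 ≤ 1 := by
    have : R 0 = U0 ^ (α + β) / (A0 * B0 ^ β * C0 ^ α) := by simp only [hRdef, zero_mul, sub_zero]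
    have hd0 : 0 < A0 * B0 ^ β * C0 ^ α :=
      mul_pos (mul_pos hA0 (Real.rpow_pos_of_pos hB0 β)) (Real.rpow_pos_of_pos hC0 α)
    rw [this, div_le_one hd0]; exact h0
  have R1 : R 1 ≤ 1 := by
    have : R 1 = U1 ^ (α + β) / (A1 * B1 ^ β * C1 ^ α) := by simp only [hRdef, one_mul, sub_sub_cancel]
    have hd1 : 0 < A1 * B1 ^ β * C1 ^ α :=
      mul_pos (mul_pos hA1 (Real.rpow_pos_of_pos hB1 β)) (Real.rpow_pos_of_pos hC1 α)
    rw [this, div_le_one hd1]; exact h1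
  -- quasi-convexity: `R z ≤ max (R 0) (R 1)`
  have qc : ∀ z ∈ Set.Icc (0 : ℝ) 1, R z ≤ max (R 0) (R 1) := by
    intro z hz
    by_contra hcon
    push Not at hcon
    obtain ⟨hz0, hz1⟩ := hz
    have hz0' : 0 < z := by
      rcases eq_or_lt_of_le hz0 with h | h
      · rw [← h] at hcon
        exact absurd (le_max_left _ _) (not_le.2 hcon)
      · exact h
    have hz1' : z < 1 := by
      rcases eq_or_lt_of_le hz1 with h | h
      · rw [h] at hcon
        exact absurd (le_max_right _ _) (not_le.2 hcon)
      · exact h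
    -- mean value theorem on `[0, z]`
    obtain ⟨c, hc, hcd⟩ := exists_deriv_eq_slope R hz0'
      (Rcont.mono (Set.Icc_subset_Icc le_rfl hz1))
      (fun y hy => (Rderiv y hy.1.le (lt_trans hy.2 hz1')).differentiableAt.differentiableWithinAt)
    obtain ⟨hc0, hcz⟩ := hc
    have hslope : 0 < (R z - R 0) / (z - 0) := by
      rw [sub_zero]; exact div_pos (by linarith [le_max_left (R 0) (R 1)]) hz0'
    rw [← hcd, (Rderiv c hc0.le (lt_trans hcz hz1')).deriv] at hslope
    have Rc : 0 < R c := by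
      have := Rnn c ⟨hc0.le, (lt_trans hcz hz1').le⟩
      rcases eq_or_lt_of_le this with h | h
      · rw [← h, zero_mul] at hslope; exact absurd hslope (lt_irrefl 0)
      · exact h
    have hc1 : c < 1 := lt_trans hcz hz1'
    have hψc : 0 < ψ c := by
      by_contra hn
      push Not at hn
      nlinarith [hslope, Rc, hn]
    -- positivity at `c`
    have Uc := posU c hc0.le hc1
    have Ac := posA c ⟨hc0.le, hc1.le⟩
    have Bc := posB c ⟨hc0.le, hc1.le⟩
    have Cc := posC c ⟨hc0.le, hc1.le⟩
    -- ROW Π at `c`, in ratio form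
    have hPic : (B0 - B1) / (B0 - c * (B0 - B1)) + (C0 - C1) / (C0 - c * (C0 - C1))
        ≤ (U0 - U1) / (U0 - c * (U0 - U1)) := by
      have hPi' : U0 * ((B0 - B1) * C0 + (C0 - C1) * B0) ≤ (U0 - U1) * B0 * C0 := hPi
      have raw := rowPi_propagate U0 (U0 - U1) B0 (B0 - B1) C0 (C0 - C1) c hc0.le hc1.le hU0.le (by linarith)
        (sub_nonneg.2 hB) (sub_nonneg.2 hC) hPi'
      rw [div_add_div _ _ Bc.ne' Cc.ne', div_le_div_iff₀ (mul_pos Bc Cc) Uc]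
      exact (raw.trans_eq (by ring)).trans_eq' (by ring)
    -- propagation: `ψ ≥ 0` on `[c, 1)`
    have prop : ∀ y, c ≤ y → y < 1 → 0 ≤ ψ y := by
      intro y hcy hy1
      have hy0 : 0 ≤ y := hc0.le.trans hcy
      have Ay := posA y ⟨hy0, hy1.le⟩
      have hδ : 0 ≤ y - c := sub_nonneg.2 hcy
      have ha : (A0 - A1) / (A0 - c * (A0 - A1)) * (y - c) < 1 := by
        rw [div_mul_eq_mul_div, div_lt_one Ac]
        nlinarith
      have P := psi_propagate_fam α β (y - c) ((U0 - U1) / (U0 - c * (U0 - U1))) ((A0 - A1) / (A0 - c * (A0 - A1)))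
        ((B0 - B1) / (B0 - c * (B0 - B1))) ((C0 - C1) / (C0 - c * (C0 - C1))) hα hβ hadm hδ
        (div_nonneg (sub_nonneg.2 hB) Bc.le) (div_nonneg (sub_nonneg.2 hC) Cc.le) hPic (by linarith [hψc.le]) ha
      have Uy := posU y hy0 hy1
      have By := posB y ⟨hy0, hy1.le⟩
      have Cy := posC y ⟨hy0, hy1.le⟩
      have sU : (U0 - U1) / (U0 - c * (U0 - U1)) / (1 - (U0 - U1) / (U0 - c * (U0 - U1)) * (y - c))
          = (U0 - U1) / (U0 - y * (U0 - U1)) := by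
        rw [phi_shift _ _ _ Uc.ne']; congr 1; ring
      have sA : (A0 - A1) / (A0 - c * (A0 - A1)) / (1 - (A0 - A1) / (A0 - c * (A0 - A1)) * (y - c))
          = (A0 - A1) / (A0 - y * (A0 - A1)) := by
        rw [phi_shift _ _ _ Ac.ne']; congr 1; ring
      have sB : (B0 - B1) / (B0 - c * (B0 - B1)) / (1 - (B0 - B1) / (B0 - c * (B0 - B1)) * (y - c))
          = (B0 - B1) / (B0 - y * (B0 - B1)) := by
        rw [phi_shift _ _ _ Bc.ne']; congr 1; ring
      have sC : (C0 - C1) / (C0 - c * (C0 - C1)) / (1 - (C0 - C1) / (C0 - c * (C0 - C1)) * (y - c))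
          = (C0 - C1) / (C0 - y * (C0 - C1)) := by
        rw [phi_shift _ _ _ Cc.ne']; congr 1; ring
      rw [sU, sA, sB, sC] at P
      exact (P.trans_eq (by ring))
    -- `R` is non-decreasing on `[c, 1]`
    have hmono : MonotoneOn R (Set.Icc c 1) := by
      refine monotoneOn_of_deriv_nonneg (convex_Icc c 1) (Rcont.mono (Set.Icc_subset_Icc hc0.le le_rfl)) ?_ ?_
      · rw [interior_Icc]
        intro y hy
        exact (Rderiv y (hc0.le.trans hy.1.le) hy.2).differentiableAt.differentiableWithinAt
      · rw [interior_Icc]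
        intro y hy
        rw [(Rderiv y (hc0.le.trans hy.1.le) hy.2).deriv]
        exact mul_nonneg (Rnn y ⟨hc0.le.trans hy.1.le, hy.2.le⟩) (prop y hy.1.le hy.2)
    have hle : R z ≤ R 1 := hmono ⟨hcz.le, hz1⟩ ⟨hc1.le, le_rfl⟩ hz1
    exact absurd (lt_of_le_of_lt (le_max_right (R 0) (R 1)) hcon) (not_lt.2 hle)
  intro z hz
  have h := le_trans (qc z hz) (max_le R0 R1)
  rwa [hRdef, div_le_one (denpos z hz)] at h

/-- **LEMMA Q_{αβ}** (memo §1).  For an admissible pair `(α,β)`: `0 ≤ U₁ ≤ U₀`, `A₀, A₁ ≥ 0`, `0 ≤ B₁ ≤ B₀`, `0 ≤ C₁ ≤ C₀`,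
`U₀^{α+β} ≤ A₀B₀^βC₀^α`, `U₁^{α+β} ≤ A₁B₁^βC₁^α` and ROW Π `U₀((B₀−B₁)C₀ + (C₀−C₁)B₀) ≤ (U₀−U₁)B₀C₀` imply
`U(z)^{α+β} ≤ A(z)B(z)^βC(z)^α` on `[0,1]`, `X(z) = X₀ − z(X₀ − X₁)`: every admissible row survives the apex-edge mixture.
(Degenerate endpoints by perturbing `A₁, B₁, C₁` upwards and letting `ε ↓ 0`.) [this work] -/
theorem family_edge_mixture (α β : ℝ) (hα : 1 ≤ α) (hβ : 1 ≤ β) (hadm : (α + β) ^ 2 ≤ α * β * (α + β + 1))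
    (U0 U1 A0 A1 B0 B1 C0 C1 : ℝ) (hU1 : 0 ≤ U1) (hU : U1 ≤ U0)
    (hA0 : 0 ≤ A0) (hA1 : 0 ≤ A1) (hB1 : 0 ≤ B1) (hB : B1 ≤ B0) (hC1 : 0 ≤ C1) (hC : C1 ≤ C0)
    (h0 : U0 ^ (α + β) ≤ A0 * B0 ^ β * C0 ^ α) (h1 : U1 ^ (α + β) ≤ A1 * B1 ^ β * C1 ^ α)
    (hPi : U0 * ((B0 - B1) * C0 + (C0 - C1) * B0) ≤ (U0 - U1) * B0 * C0) :
    ∀ z ∈ Set.Icc (0 : ℝ) 1,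
      (U0 - z * (U0 - U1)) ^ (α + β) ≤ (A0 - z * (A0 - A1)) * (B0 - z * (B0 - B1)) ^ β * (C0 - z * (C0 - C1)) ^ α := by
  intro z hz
  obtain ⟨hz0, hz1⟩ := hz
  have hα0 : 0 ≤ α := zero_le_one.trans hα
  have hβ0 : 0 ≤ β := zero_le_one.trans hβ
  have hn : (α + β) ≠ 0 := by linarith
  have hB0 : 0 ≤ B0 := hB1.trans hB
  have hC0 : 0 ≤ C0 := hC1.trans hC
  have Az : 0 ≤ A0 - z * (A0 - A1) := by nlinarith [mul_nonneg hz0 hA1]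
  have Bz : 0 ≤ B0 - z * (B0 - B1) := by nlinarith [mul_nonneg hz0 hB1]
  have Cz : 0 ≤ C0 - z * (C0 - C1) := by nlinarith [mul_nonneg hz0 hC1]
  rcases eq_or_lt_of_le (hU1.trans hU) with hU0 | hU0
  · -- `U₀ = 0`: then `U ≡ 0`
    have hU1' : U1 = 0 := le_antisymm (hU0 ▸ hU) hU1
    have : U0 - z * (U0 - U1) = 0 := by rw [← hU0, hU1']; ring
    rw [this, Real.zero_rpow hn]
    exact mul_nonneg (mul_nonneg Az (Real.rpow_nonneg Bz β)) (Real.rpow_nonneg Cz α)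
  -- `U₀ > 0`, hence `A₀, B₀, C₀ > 0`
  have hpos : 0 < A0 * B0 ^ β * C0 ^ α := lt_of_lt_of_le (Real.rpow_pos_of_pos hU0 _) h0
  have hA0' : 0 < A0 := by
    rcases eq_or_lt_of_le hA0 with h | h
    · rw [← h] at hpos; simp at hpos
    · exact h
  have hB0' : 0 < B0 := by
    rcases eq_or_lt_of_le hB0 with h | h
    · rw [← h, Real.zero_rpow (by linarith)] at hpos; simp at hpos
    · exact h
  have hC0' : 0 < C0 := by
    rcases eq_or_lt_of_le hC0 with h | h
    · rw [← h, Real.zero_rpow (by linarith)] at hpos; simp at hpos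
    · exact h
  have hS0 : 0 ≤ U0 * ((B0 - B1) * C0 + (C0 - C1) * B0) :=
    mul_nonneg hU0.le (add_nonneg (mul_nonneg (sub_nonneg.2 hB) hC0) (mul_nonneg (sub_nonneg.2 hC) hB0))
  -- the perturbed problems
  have key : ∀ ε : ℝ, 0 < ε → ε < 1 →
      (U0 - z * (U0 - U1)) ^ (α + β) ≤ (A0 - z * (A0 - (A1 + ε * A0))) * (B0 - z * (B0 - (B1 + ε * (B0 - B1)))) ^ β
        * (C0 - z * (C0 - (C1 + ε * (C0 - C1)))) ^ α := by
    intro ε hε hε1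
    have h1ε : 0 ≤ 1 - ε := sub_nonneg.2 hε1.le
    have hA1e : 0 < A1 + ε * A0 := add_pos_of_nonneg_of_pos hA1 (mul_pos hε hA0')
    have hB1e : 0 < B1 + ε * (B0 - B1) := by
      have e : B1 + ε * (B0 - B1) = (1 - ε) * B1 + ε * B0 := by ring
      rw [e]; exact add_pos_of_nonneg_of_pos (mul_nonneg h1ε hB1) (mul_pos hε hB0')
    have hBe : B1 + ε * (B0 - B1) ≤ B0 := by
      have e : B0 - (B1 + ε * (B0 - B1)) = (1 - ε) * (B0 - B1) := by ring
      have : 0 ≤ (1 - ε) * (B0 - B1) := mul_nonneg h1ε (sub_nonneg.2 hB)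
      linarith
    have hC1e : 0 < C1 + ε * (C0 - C1) := by
      have e : C1 + ε * (C0 - C1) = (1 - ε) * C1 + ε * C0 := by ring
      rw [e]; exact add_pos_of_nonneg_of_pos (mul_nonneg h1ε hC1) (mul_pos hε hC0')
    have hCe : C1 + ε * (C0 - C1) ≤ C0 := by
      have e : C0 - (C1 + ε * (C0 - C1)) = (1 - ε) * (C0 - C1) := by ring
      have : 0 ≤ (1 - ε) * (C0 - C1) := mul_nonneg h1ε (sub_nonneg.2 hC)
      linarith
    have h1e : U1 ^ (α + β) ≤ (A1 + ε * A0) * (B1 + ε * (B0 - B1)) ^ β * (C1 + ε * (C0 - C1)) ^ α := by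
      have eA : A1 ≤ A1 + ε * A0 := le_add_of_nonneg_right (mul_pos hε hA0').le
      have eB : B1 ^ β ≤ (B1 + ε * (B0 - B1)) ^ β :=
        Real.rpow_le_rpow hB1 (le_add_of_nonneg_right (mul_nonneg hε.le (sub_nonneg.2 hB))) hβ0
      have eC : C1 ^ α ≤ (C1 + ε * (C0 - C1)) ^ α :=
        Real.rpow_le_rpow hC1 (le_add_of_nonneg_right (mul_nonneg hε.le (sub_nonneg.2 hC))) hα0
      calc U1 ^ (α + β) ≤ A1 * B1 ^ β * C1 ^ α := h1
        _ ≤ (A1 + ε * A0) * (B1 + ε * (B0 - B1)) ^ β * (C1 + ε * (C0 - C1)) ^ α :=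
          mul_le_mul (mul_le_mul eA eB (Real.rpow_nonneg hB1 β) hA1e.le) eC (Real.rpow_nonneg hC1 α)
            (mul_nonneg hA1e.le (Real.rpow_nonneg hB1e.le β))
    have hPie : U0 * ((B0 - (B1 + ε * (B0 - B1))) * C0 + (C0 - (C1 + ε * (C0 - C1))) * B0) ≤ (U0 - U1) * B0 * C0 := by
      have e : U0 * ((B0 - (B1 + ε * (B0 - B1))) * C0 + (C0 - (C1 + ε * (C0 - C1))) * B0)
          = U0 * ((B0 - B1) * C0 + (C0 - C1) * B0) - ε * (U0 * ((B0 - B1) * C0 + (C0 - C1) * B0)) := by ring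
      have : 0 ≤ ε * (U0 * ((B0 - B1) * C0 + (C0 - C1) * B0)) := mul_nonneg hε.le hS0
      linarith
    exact family_edge_mixture_pos α β hα hβ hadm U0 U1 A0 (A1 + ε * A0) B0 (B1 + ε * (B0 - B1)) C0 (C1 + ε * (C0 - C1))
      hU0 hU1 hA0' hA1e hB1e hBe hC1e hCe h0 h1e hPie z ⟨hz0, hz1⟩
  -- the limit `ε ↓ 0`
  have hcont : Continuous fun ε : ℝ => (A0 - z * (A0 - (A1 + ε * A0))) * (B0 - z * (B0 - (B1 + ε * (B0 - B1)))) ^ β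
      * (C0 - z * (C0 - (C1 + ε * (C0 - C1)))) ^ α := by
    refine Continuous.mul (Continuous.mul (by fun_prop) ?_) ?_
    · exact (by fun_prop : Continuous fun ε : ℝ => B0 - z * (B0 - (B1 + ε * (B0 - B1)))).rpow_const fun _ => Or.inr hβ0
    · exact (by fun_prop : Continuous fun ε : ℝ => C0 - z * (C0 - (C1 + ε * (C0 - C1)))).rpow_const fun _ => Or.inr hα0
  have hlim := (hcont.tendsto 0).mono_left (nhdsWithin_le_nhds (s := Set.Ioi (0 : ℝ)))
  have hev : ∀ᶠ ε in nhdsWithin (0 : ℝ) (Set.Ioi 0), (U0 - z * (U0 - U1)) ^ (α + β)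
      ≤ (A0 - z * (A0 - (A1 + ε * A0))) * (B0 - z * (B0 - (B1 + ε * (B0 - B1)))) ^ β
        * (C0 - z * (C0 - (C1 + ε * (C0 - C1)))) ^ α :=
    Filter.eventually_of_mem (Ioo_mem_nhdsGT zero_lt_one) fun ε hε => key ε hε.1 hε.2
  have := le_of_tendsto_of_tendsto tendsto_const_nhds hlim hev
  simpa using this


/-- LEMMA Q_{αβ} in the convex-combination form `X(z) = (1−z)X₀ + zX₁` used by the induction (`…APLFamilyAll`). [this work] -/
theorem family_edge_mixture' (α β : ℝ) (hα : 1 ≤ α) (hβ : 1 ≤ β) (hadm : (α + β) ^ 2 ≤ α * β * (α + β + 1))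
    (U0 U1 A0 A1 B0 B1 C0 C1 : ℝ) (hU1 : 0 ≤ U1) (hU : U1 ≤ U0)
    (hA0 : 0 ≤ A0) (hA1 : 0 ≤ A1) (hB1 : 0 ≤ B1) (hB : B1 ≤ B0) (hC1 : 0 ≤ C1) (hC : C1 ≤ C0)
    (h0 : U0 ^ (α + β) ≤ A0 * B0 ^ β * C0 ^ α) (h1 : U1 ^ (α + β) ≤ A1 * B1 ^ β * C1 ^ α)
    (hPi : U0 * ((B0 - B1) * C0 + (C0 - C1) * B0) ≤ (U0 - U1) * B0 * C0) (z : ℝ) (hz : z ∈ Set.Icc (0 : ℝ) 1) :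
    ((1 - z) * U0 + z * U1) ^ (α + β) ≤ ((1 - z) * A0 + z * A1) * ((1 - z) * B0 + z * B1) ^ β * ((1 - z) * C0 + z * C1) ^ α := by
  have e : ∀ X0 X1 : ℝ, (1 - z) * X0 + z * X1 = X0 - z * (X0 - X1) := fun _ _ => by ring
  rw [e, e, e, e]
  exact family_edge_mixture α β hα hβ hadm U0 U1 A0 A1 B0 B1 C0 C1 hU1 hU hA0 hA1 hB1 hB hC1 hC h0 h1 hPi z hz

end APL

end Summit.CriticalPhenomena.PercolationContinuityZ3.Theorems
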